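import Literature.AnabelianGeometry.AbsoluteAnabelian.AbsTopIII.BirationalReconstruction
import Literature.AnabelianGeometry.AbsoluteAnabelian.AbsTopIII.KummerFaithfulPadicAbelianProofs
import Literature.NumberTheory.GaloisRepresentations.AbsGaloisRestrictSurjective
import HarnessLib

/-!
# [AbsTopIII] Rmk. 1.11.1 (i) as printed: over MLF's the reconstruction of Thm. 1.11 is ABSOLUTE —
# derived from the two typed closed facts `Thm_1_11` (F-0336) and `Rmk_1_11_1_i` (F-0335) (proof-only)

S. Mochizuki, *Topics in Absolute Anabelian Geometry III: global reconstruction algorithms*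
[MochizukiAbsTopIII2015], §1, Thm. 1.11 pp. 45–47 and Rmk. 1.11.1 (i) p. 47 of the author's
manuscript (`paper:url-5493eb38cbb7`): "when `k` is an MLF, the semi-absolute algorithms of
Theorem 1.11 may be rendered absolute [i.e., one may construct the kernel of the quotient
`Π_{η_X} ↠ G_k`] by applying the algorithm implicit in the proof of [Mzk21], Corollary 2.10".
Cell abc-iut, block F (fact-proving wave), seat abc-iut-f-075 (tranche 75 = F-0334…F-0337).
PROOF-ONLY companion of `BirationalReconstruction.lean` (abc-iut-L4-t1; imported, never edited):
no definition, no instance, no new `Prop` fact.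

WHAT IS PROVED.  The trunk types Rmk. 1.11.1 (i) as the closed fact `Rmk_1_11_1_i` ("every
bicontinuous isomorphism `Gal(K̄/K) ≅ Gal(K̄'/K')` of absolute Galois groups of function fields of
genus `≥ 2` over MLF's carries `Δ_{η_X}` onto `Δ_{η_{X'}}`") and Thm. 1.11 as `Thm_1_11` (a
functorial algorithm on EXTENSIONS `1 → Δ → Π → G → 1`).  The printed USE of Rmk. 1.11.1 (i) is the
composite: an isomorphism of the bare profinite groups `Π_{η_X} ≅ Π_{η_{X'}}` — no augmentation
given — already induces `K_X ≅ K_{X'}` over `k ≅ k'`.  This file kernel-checks that the two typed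
rows DO compose to that printed absolute statement:

* `FundamentalExtension.nonempty_iso_of_geom_map_eq` — pure topological group theory, every
  universe: a bicontinuous `α : Π_E ≅ Π_F` with `α(Δ_E) = Δ_F` extends to an isomorphism of
  extensions `E ≅ F` (the `G`-component is induced on `Π/Δ ≅ G`; it is bicontinuous because the
  augmentations are quotient maps of compact Hausdorff groups);
* `Thm_1_11_isom_absolute_of_isMLF` — GIVEN `Thm_1_11` and `Rmk_1_11_1_i` (named-fact hypotheses,
  FACT-LIST F-0336 / F-0335, both OUTSIDE the [IUTchIII] Cor. 3.12 cone), for function fields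
  `K/k`, `K'/k'` of one variable of genus `≥ 2` with `k`, `k'` MLF's algebraically closed in them,
  EVERY `e : Gal(K̄/K) ≃ₜ* Gal(K̄'/K')` yields `k ≃+* k'`, `K ≃+* K'` compatible with `k ⊆ K`,
  `k' ⊆ K'`.  The remaining binders of the rows are DISCHARGED by tree theorems: `hsurj`
  (`Gal(K̄/K) ↠ Gal(k̄/k)`, Lang *Algebra* VI §1 Thm. 1.12: `absGaloisRestrict_surjective_of_isIntegrallyClosedIn`,
  p430063) and Kummer-faithfulness of MLF's (`IsMLF.isKummerFaithful`, abc-iut L4 lineage).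
* `Thm_1_11_isom_absolute_self_of_isMLF` — the one-field case (every bicontinuous automorphism of
  `Gal(K̄/K)` induces an automorphism of `K` over an automorphism of `k`), the shape in which
  "absolute anabelian" results are consumed.

HONEST LABEL: CONDITIONAL on the two named facts (nothing of [AbsTopIII] Thm. 1.11 / [AbsTopII]
Cor. 2.10 is proved here — those are the deep inputs, recorded as F-0336 / F-0335 «NEEDS» on the
cell's STATUS 2026-08-26 06:30Z); what is proved is that the TYPED rows are jointly SUFFICIENT for
the printed absolute statement (faithfulness-of-typing evidence for F-0335: its typed form is the
one Rmk. 1.11.1 (i) needs).  Refereed pre-IUT anabelian geometry; nothing here bears on the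
disputed [IUTchIII] Cor. 3.12; no side taken; typed ≠ proved.
-/

noncomputable section

open CategoryTheory

namespace Literature.AnabelianGeometry.AbsoluteAnabelian

universe u

/-! ### An isomorphism of extensions from a `Δ`-preserving bicontinuous isomorphism of `Π`'s -/

namespace FundamentalExtension

variable {E F : FundamentalExtension.{u}}

/-- The map `G_E → G_F` induced on `Π/Δ ≅ G` by a `Δ`-preserving `α : Π_E ≅ Π_F`, as an abstract
group isomorphism, with its defining square `β (aug_E x) = aug_F (α x)`.
[cite: MochizukiAbsTopIII2015, Rmk 1.11.1 (i) p.47] -/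
theorem exists_mulEquiv_gal_of_geom_map_eq (α : E.arith ≃ₜ* F.arith)
    (hα : E.geom.map α.toMulEquiv.toMonoidHom = F.geom) :
    ∃ β : E.gal ≃* F.gal, ∀ x : E.arith, β (E.aug x) = F.aug (α x) := by
  refine ⟨E.quotientGeomEquivGal.symm.trans
    ((QuotientGroup.congr E.geom F.geom α.toMulEquiv hα).trans F.quotientGeomEquivGal), fun x => ?_⟩
  have h1 : E.quotientGeomEquivGal.symm (E.aug x) = QuotientGroup.mk x := by
    rw [MulEquiv.symm_apply_eq]
    rfl
  rw [MulEquiv.trans_apply, MulEquiv.trans_apply, h1]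
  rfl

/-- **A `Δ`-preserving bicontinuous isomorphism `α : Π_E ≅ Π_F` extends to an isomorphism of
extensions `E ≅ F`** whose `Π`-component is `α`: the `G`-component is the map induced on
`Π/Δ ≅ G`, bicontinuous since the augmentations `Π ↠ G` are quotient maps (continuous surjections
of compact Hausdorff groups).  This is the formal content of "rendered absolute [i.e., one may
construct the kernel of the quotient `Π_{η_X} ↠ G_k`]": once `Δ` is known inside `Π`, the whole
extension is. [cite: MochizukiAbsTopIII2015, Rmk 1.11.1 (i) p.47] -/
theorem nonempty_iso_of_geom_map_eq (α : E.arith ≃ₜ* F.arith)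
    (hα : E.geom.map α.toMulEquiv.toMonoidHom = F.geom) :
    ∃ φ : E ≅ F, φ.hom.arith = (α : E.arith →ₜ* F.arith) := by
  obtain ⟨β, hβ⟩ := exists_mulEquiv_gal_of_geom_map_eq α hα
  have hqE : Topology.IsQuotientMap E.aug :=
    ((map_continuous E.aug).isClosedMap).isQuotientMap (map_continuous E.aug) E.aug_surjective
  have hqF : Topology.IsQuotientMap F.aug :=
    ((map_continuous F.aug).isClosedMap).isQuotientMap (map_continuous F.aug) F.aug_surjective
  have hβ' : ∀ y : F.arith, β.symm (F.aug y) = E.aug (α.symm y) := fun y => by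
    rw [MulEquiv.symm_apply_eq, hβ, ContinuousMulEquiv.apply_symm_apply]
  have hcont : Continuous β := by
    rw [hqE.continuous_iff, show (β : E.gal → F.gal) ∘ E.aug = F.aug ∘ α from funext hβ]
    exact (map_continuous F.aug).comp (map_continuous α)
  have hcont' : Continuous β.symm := by
    rw [hqF.continuous_iff, show (β.symm : F.gal → E.gal) ∘ F.aug = E.aug ∘ α.symm from funext hβ']
    exact (map_continuous E.aug).comp (map_continuous α.symm)
  let βc : E.gal →ₜ* F.gal := ⟨β.toMonoidHom, hcont⟩
  let βc' : F.gal →ₜ* E.gal := ⟨β.symm.toMonoidHom, hcont'⟩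
  refine ⟨{ hom := ⟨(α : E.arith →ₜ* F.arith), βc, fun x => (hβ x).symm⟩
            inv := ⟨(α.symm : F.arith →ₜ* E.arith), βc', fun y => (hβ' y).symm⟩
            hom_inv_id := Hom.ext (ContinuousMonoidHom.ext fun x => α.symm_apply_apply x)
              (ContinuousMonoidHom.ext fun g => β.symm_apply_apply g)
            inv_hom_id := Hom.ext (ContinuousMonoidHom.ext fun y => α.apply_symm_apply y)
              (ContinuousMonoidHom.ext fun g => β.apply_symm_apply g) }, rfl⟩

end FundamentalExtension

/-! ### Rmk. 1.11.1 (i): the absolute form of Thm. 1.11 over MLF's, from the two typed rows -/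

namespace AbsTopIII

open Literature.NumberTheory.GaloisRepresentations (absGaloisRestrict
  absGaloisRestrict_surjective_of_isIntegrallyClosedIn)
open Literature.NumberTheory.DiophantineGeometry
open Literature.NumberTheory.DiophantineGeometry.AlgFunctionField

/-- **[AbsTopIII] Rmk. 1.11.1 (i), printed content, DERIVED from the typed rows F-0336 + F-0335.**
GIVEN the named facts `Thm_1_11` (semi-absolute functorial reconstruction of function fields of
genus `≥ 2` over Kummer-faithful fields) and `Rmk_1_11_1_i` (over MLF's every bicontinuous
`Gal(K̄/K) ≅ Gal(K̄'/K')` carries `Δ_{η_X}` onto `Δ_{η_{X'}}`): for `K/k`, `K'/k'` algebraic function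
fields of one variable of genus `≥ 2` whose constant fields `k`, `k'` are MLF's algebraically closed
in them, EVERY isomorphism of profinite groups `e : Gal(K̄/K) ≃ₜ* Gal(K̄'/K')` — with no
augmentation data — induces field isomorphisms `k ≃+* k'`, `K ≃+* K'` compatible with the
inclusions.  The rows' other binders are theorems: surjectivity of `Gal(K̄/K) → Gal(k̄/k)`
(`absGaloisRestrict_surjective_of_isIntegrallyClosedIn`, Lang *Algebra* VI §1 Thm. 1.12) and
Kummer-faithfulness of MLF's (`IsMLF.isKummerFaithful`).  CONDITIONAL on F-0336 / F-0335 (deep,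
outside the Cor. 3.12 cone). [cite: MochizukiAbsTopIII2015, Rmk 1.11.1 (i) p.47]
[cite: MochizukiAbsTopIII2015, Thm 1.11 p.46] -/
theorem Thm_1_11_isom_absolute_of_isMLF (h : Thm_1_11.{u}) (h' : Rmk_1_11_1_i.{u})
    (k K : Type u) [Field k] [CharZero k] [Field K] [CharZero K] [Algebra k K]
    [IsAlgFunctionField k K] [IsIntegrallyClosedIn k K]
    (k' K' : Type u) [Field k'] [CharZero k'] [Field K'] [CharZero K'] [Algebra k' K']
    [IsAlgFunctionField k' K'] [IsIntegrallyClosedIn k' K']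
    (hk : IsMLF k) (hk' : IsMLF k') (hg : 2 ≤ genus k K) (hg' : 2 ≤ genus k' K')
    (e : Field.absoluteGaloisGroup K ≃ₜ* Field.absoluteGaloisGroup K') :
    ∃ (eb : k ≃+* k') (ef : K ≃+* K'), ∀ c, ef (algebraMap k K c) = algebraMap k' K' (eb c) := by
  have hsurj := absGaloisRestrict_surjective_of_isIntegrallyClosedIn k K
  have hsurj' := absGaloisRestrict_surjective_of_isIntegrallyClosedIn k' K'
  -- Rmk. 1.11.1 (i): `e` carries `Δ_{η_X}` onto `Δ_{η_{X'}}`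
  have hΔ : (genericPointExtension k K hsurj).geom.map e.toMulEquiv.toMonoidHom =
      (genericPointExtension k' K' hsurj').geom :=
    h' k K hsurj k' K' hsurj' hk hk' hg hg' e
  -- hence `e` extends to an isomorphism of the extensions attached to the generic points
  obtain ⟨φ, -⟩ := FundamentalExtension.nonempty_iso_of_geom_map_eq
    (E := genericPointExtension k K hsurj) (F := genericPointExtension k' K' hsurj') e hΔ
  -- Thm. 1.11 (functoriality in isomorphisms of extensions)
  exact Thm_1_11_isom h k K hsurj k' K' hsurj' hk.isKummerFaithful hk'.isKummerFaithful hg hg' ⟨φ⟩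

/-- **One-field case** (the shape in which absolute anabelian results are consumed): GIVEN
`Thm_1_11` and `Rmk_1_11_1_i`, every bicontinuous AUTOMORPHISM of the absolute Galois group
`Gal(K̄/K)` of a function field of genus `≥ 2` over an MLF `k` algebraically closed in `K` induces a
field automorphism of `K` over a field automorphism of `k`.
[cite: MochizukiAbsTopIII2015, Rmk 1.11.1 (i) p.47] -/
theorem Thm_1_11_isom_absolute_self_of_isMLF (h : Thm_1_11.{u}) (h' : Rmk_1_11_1_i.{u})
    (k K : Type u) [Field k] [CharZero k] [Field K] [CharZero K] [Algebra k K]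
    [IsAlgFunctionField k K] [IsIntegrallyClosedIn k K]
    (hk : IsMLF k) (hg : 2 ≤ genus k K)
    (e : Field.absoluteGaloisGroup K ≃ₜ* Field.absoluteGaloisGroup K) :
    ∃ (eb : k ≃+* k) (ef : K ≃+* K), ∀ c, ef (algebraMap k K c) = algebraMap k K (eb c) :=
  Thm_1_11_isom_absolute_of_isMLF h h' k K k K hk hk hg hg e

end AbsTopIII

end Literature.AnabelianGeometry.AbsoluteAnabelian

end
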